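import Mathlib.Analysis.SpecialFunctions.Trigonometric.ArctanDeriv
import Literature.NumberTheory.LFunctions.PolyaSignChangesMomentDefs
import Literature.NumberTheory.LFunctions.PolyaSignChangesNearestPole

/-!
# Pólya's sign-change theorem (Grosswald 1967, Theorem B) — PieceB: the pole nearest to a large
# real point ("infinite height" bookkeeping)

Topic `Literature/NumberTheory/LFunctions` (namespace `Literature.NumberTheory.LFunctions`, grouping
sub-namespace `PolyaSignChanges`).  Part of the moment-method proof of the named fact
`Grosswald1967_thmB` (see `PolyaSignChangesMomentDefs` for the architecture and the composition
`grosswald1967_thmB_of : PieceA → PieceB → Grosswald1967_thmB`).  This file proves `PieceB`: under the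
hypotheses of Theorem B (continuation `Φ` of `F = Landau.mellinIoi g` meromorphic on `{θ − ε₀ < re}`,
holomorphic on `{θ < re}` and on a box `{θ − η < re, |im| < Γ}`, `F` not continuable to any
`{θ − ε < re}`), for every `ε > 0` there are admissible pole-pair data `(λ, x, R', ρ, Ψ)` with
`λ·arctan(γ/(λ−β))/x ≥ Γ − ε`.  Printed source of the statement: Grosswald, TAMS 126 (1967) §4
Theorem B pp. 4–5 (Pólya 1930; the case `γ = +∞` by Steinig 1969) — the bookkeeping below treats the
cases `P ≠ ∅` and `P = ∅` uniformly (the pole of the normal form of `Φ` nearest to a large generic real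
`λ`), so no case distinction on `γ < ∞` is needed.

## Contents

* §1 `stub_rateLimit` — the real-variable parameter arithmetic: with `x = 1 + δ`,
  `δ = min(1/2, ε/(2Γ))`, and `λ → ∞`, the clauses `λ ≤ x(λ − σ₁)`, the tail inequality
  `x·exp(1 − x(λ−σ₁)/λ)·|λ − ρ| < λ` and the rate bound `λ·arctan(γ/(λ−β))/x ≥ Γ − ε` hold as soon as
  `θ − η < β ≤ θ`, `Γ ≤ γ`, `γ² ≤ Cλ` (limits: `x e^{1−x} < 1`, `λ·arctan(Γ/(λ+c)) → Γ`).
* §2 `pieceB : PieceB` — assembled from `stub_nearestPole` (file `PolyaSignChangesNearestPole`, with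
  its lemmas in `PolyaSignChangesPoleLemmas`) and `stub_rateLimit`, exactly as the skeleton's
  kernel-checked plumbing `pieceB_of_stubs`.

Nothing in this file bears on the truth of RH; no summit statement is proved here.
[cite: Grosswald1967, §4 Thm B pp. 4–5]
-/

noncomputable section

open Complex Set MeasureTheory Filter Topology Metric

namespace Literature.NumberTheory.LFunctions.PolyaSignChanges

/-! ## §1 Parameter arithmetic (`stub_rateLimit`) -/

/-- `arctan w / w → 1` as `w → 0`, `w ≠ 0` (derivative of `arctan` at `0`). [folklore] -/
private theorem tendsto_arctan_div_self :
    Tendsto (fun w : ℝ => Real.arctan w / w) (𝓝[≠] 0) (𝓝 1) := by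
  have h := (Real.hasDerivAt_arctan 0)
  rw [hasDerivAt_iff_tendsto_slope_zero] at h
  simp only [zero_add, Real.arctan_zero, sub_zero, smul_eq_mul] at h
  have h1 : (1 : ℝ) / (1 + 0 ^ 2) = 1 := by norm_num
  rw [h1] at h
  refine h.congr' ?_
  filter_upwards [self_mem_nhdsWithin] with w hw
  rw [inv_mul_eq_div]

/-- `λ · arctan(Γ/(λ + c)) → Γ` as `λ → +∞` (`Γ > 0`). [folklore] -/
private theorem tendsto_mul_arctan_div (Γ c : ℝ) (hΓ : 0 < Γ) :
    Tendsto (fun lam : ℝ => lam * Real.arctan (Γ / (lam + c))) atTop (𝓝 Γ) := by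
  -- z(λ) = Γ/(λ+c) → 0, eventually positive
  have hz0 : Tendsto (fun lam : ℝ => Γ / (lam + c)) atTop (𝓝 0) :=
    tendsto_const_nhds.div_atTop (tendsto_atTop_add_const_right _ _ tendsto_id)
  have hzpos : ∀ᶠ lam : ℝ in atTop, 0 < lam + c := by
    filter_upwards [eventually_gt_atTop (-c)] with lam hlam
    linarith
  have hz : Tendsto (fun lam : ℝ => Γ / (lam + c)) atTop (𝓝[≠] 0) := by
    refine tendsto_nhdsWithin_iff.2 ⟨hz0, ?_⟩
    filter_upwards [hzpos] with lam hlam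
    exact (div_pos hΓ hlam).ne'
  have h1 : Tendsto (fun lam : ℝ => Real.arctan (Γ / (lam + c)) / (Γ / (lam + c))) atTop (𝓝 1) :=
    tendsto_arctan_div_self.comp hz
  -- λ Γ/(λ+c) → Γ
  have h2 : Tendsto (fun lam : ℝ => Γ / (1 + c / lam)) atTop (𝓝 Γ) := by
    have : Tendsto (fun lam : ℝ => 1 + c / lam) atTop (𝓝 (1 + 0)) :=
      tendsto_const_nhds.add (tendsto_const_nhds.div_atTop tendsto_id)
    rw [add_zero] at this
    have h := (tendsto_const_nhds (x := Γ)).div this one_ne_zero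
    rw [div_one] at h
    exact h
  have h2' : Tendsto (fun lam : ℝ => lam * (Γ / (lam + c))) atTop (𝓝 Γ) := by
    refine h2.congr' ?_
    filter_upwards [hzpos, eventually_gt_atTop (0 : ℝ)] with lam hlam hlam0
    field_simp
  have h3 := h1.mul h2'
  rw [one_mul] at h3
  refine h3.congr' ?_
  filter_upwards [hzpos] with lam hlam
  have hz' : Γ / (lam + c) ≠ 0 := (div_pos hΓ hlam).ne'
  field_simp

/-- **Parameter arithmetic of PieceB** (`stub_rateLimit` of the A1 skeleton, signature verbatim).  Given
`σ₁ θ η Γ C ε` with `Γ, ε > 0` there are `x > 1` and `Λ₀` such that for every real `λ ≥ Λ₀` and every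
`ρ = β + iγ` with `θ − η < β ≤ θ`, `Γ ≤ γ`, `γ² ≤ Cλ`: `λ ≤ x(λ − σ₁)`, the tail inequality
`x·exp(1 − x(λ−σ₁)/λ)·‖λ − ρ‖ < λ`, and `Γ − ε ≤ π·polePairRate λ x ρ = λ·arctan(γ/(λ−β))/x`.
Proof: `x = 1 + δ`, `δ = min(1/2, ε/(2Γ))`; `κ := x e^{1−x} < 1` and
`κ² e^{2xσ₁/λ}((λ+c)²+|C|λ)/λ² → κ²` (`c = η − θ`) give the tail clause by comparing squares;
`λ·arctan(Γ/(λ+c)) → Γ` and monotonicity of `arctan` give the rate clause.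
[cite: Grosswald1967, §4 Thm B pp. 4–5] -/
theorem stub_rateLimit (σ₁ θ η Γ C ε : ℝ) (hΓ : 0 < Γ) (hε : 0 < ε) :
    ∃ (x Λ₀ : ℝ), 1 < x ∧ ∀ (lam : ℝ) (ρ : ℂ), Λ₀ ≤ lam → θ - η < ρ.re → ρ.re ≤ θ → Γ ≤ ρ.im →
      ρ.im ^ 2 ≤ C * lam →
      lam ≤ x * (lam - σ₁) ∧ x * Real.exp (1 - x * (lam - σ₁) / lam) * ‖(lam : ℂ) - ρ‖ < lam ∧
      Γ - ε ≤ Real.pi * polePairRate lam x ρ := by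
  -- parameters
  set δ : ℝ := min (1 / 2) (ε / (2 * Γ)) with hδ_def
  have hδpos : 0 < δ := lt_min (by norm_num) (div_pos hε (by positivity))
  have hδhalf : δ ≤ 1 / 2 := min_le_left _ _
  have hδε : δ ≤ ε / (2 * Γ) := min_le_right _ _
  set x : ℝ := 1 + δ with hx_def
  have hx1 : 1 < x := by linarith
  have hxpos : 0 < x := by linarith
  set c : ℝ := η - θ with hc_def
  -- κ = x e^{1-x} < 1
  set κ : ℝ := x * Real.exp (1 - x) with hκ_def
  have hκpos : 0 < κ := mul_pos hxpos (Real.exp_pos _)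
  have hκ1 : κ < 1 := by
    have h := Real.add_one_lt_exp (x := x - 1) (by linarith)
    have : x < Real.exp (x - 1) := by linarith
    calc κ = x * Real.exp (1 - x) := rfl
      _ < Real.exp (x - 1) * Real.exp (1 - x) :=
          mul_lt_mul_of_pos_right this (Real.exp_pos _)
      _ = 1 := by rw [← Real.exp_add]; norm_num
  -- (ii) limit: κ² e^{2xσ₁/λ} ((λ+c)² + |C| λ)/λ² → κ² < 1
  have hlimii : Tendsto (fun lam : ℝ => κ ^ 2 * Real.exp (2 * x * σ₁ / lam) *
      (((lam + c) ^ 2 + |C| * lam) / lam ^ 2)) atTop (𝓝 (κ ^ 2)) := by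
    have he : Tendsto (fun lam : ℝ => Real.exp (2 * x * σ₁ / lam)) atTop (𝓝 1) := by
      have : Tendsto (fun lam : ℝ => 2 * x * σ₁ / lam) atTop (𝓝 0) :=
        tendsto_const_nhds.div_atTop tendsto_id
      have h := Real.continuous_exp.continuousAt.tendsto.comp this
      rw [Real.exp_zero] at h
      exact h
    have hq : Tendsto (fun lam : ℝ => ((lam + c) ^ 2 + |C| * lam) / lam ^ 2) atTop (𝓝 1) := by
      have h' : Tendsto (fun lam : ℝ => (1 + c / lam) ^ 2 + |C| / lam) atTop (𝓝 ((1 + 0) ^ 2 + 0)) :=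
        ((tendsto_const_nhds.add (tendsto_const_nhds.div_atTop tendsto_id)).pow 2).add
          (tendsto_const_nhds.div_atTop tendsto_id)
      simp only [add_zero, one_pow] at h'
      refine h'.congr' ?_
      filter_upwards [eventually_gt_atTop (0 : ℝ)] with lam hlam
      field_simp
    have := (he.const_mul (κ ^ 2)).mul hq
    simpa using this
  have hevii : ∀ᶠ lam : ℝ in atTop, κ ^ 2 * Real.exp (2 * x * σ₁ / lam) *
      (((lam + c) ^ 2 + |C| * lam) / lam ^ 2) < 1 :=
    hlimii.eventually (gt_mem_nhds (by nlinarith))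
  -- (iii) limit: λ arctan(Γ/(λ+c)) → Γ > Γ - ε/2
  have heviii : ∀ᶠ lam : ℝ in atTop, Γ - ε / 2 < lam * Real.arctan (Γ / (lam + c)) :=
    (tendsto_mul_arctan_div Γ c hΓ).eventually (lt_mem_nhds (by linarith))
  -- collect
  obtain ⟨Λ₀, hΛ₀⟩ := eventually_atTop.1 (hevii.and (heviii.and
    ((eventually_ge_atTop (max (max 1 (θ + 1)) (max (x * |σ₁| / δ + 1) (-c + 1)))))))
  refine ⟨x, Λ₀, hx1, ?_⟩
  intro lam ρ hlam hβ1 hβ2 hγ hγC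
  obtain ⟨hii, hiii, hbig⟩ := hΛ₀ lam hlam
  have hlam1 : 1 ≤ lam := le_trans (le_trans (le_max_left _ _) (le_max_left _ _)) hbig
  have hlamθ : θ + 1 ≤ lam := le_trans (le_trans (le_max_right _ _) (le_max_left _ _)) hbig
  have hlamσ : x * |σ₁| / δ + 1 ≤ lam := le_trans (le_trans (le_max_left _ _) (le_max_right _ _)) hbig
  have hlamc : -c + 1 ≤ lam := le_trans (le_trans (le_max_right _ _) (le_max_right _ _)) hbig
  have hlampos : 0 < lam := by linarith
  have hcpos : 0 < lam + c := by linarith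
  have hγpos : 0 < ρ.im := lt_of_lt_of_le hΓ hγ
  have hlamβ : 0 < lam - ρ.re := by linarith
  have hlamβ' : lam - ρ.re ≤ lam + c := by rw [hc_def]; linarith
  refine ⟨?_, ?_, ?_⟩
  · -- (i) λ ≤ x (λ − σ₁) ⇔ x σ₁ ≤ δ λ
    have h1 : x * |σ₁| / δ ≤ lam := by linarith
    have h2 : x * |σ₁| ≤ δ * lam := by
      rw [div_le_iff₀ hδpos] at h1; linarith [mul_comm lam δ]
    have h3 : x * σ₁ ≤ x * |σ₁| := mul_le_mul_of_nonneg_left (le_abs_self _) hxpos.le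
    rw [hx_def] at h2 h3 ⊢; nlinarith
  · -- (ii) tail inequality, by comparing squares
    have hR2 : ‖(lam : ℂ) - ρ‖ ^ 2 = (lam - ρ.re) ^ 2 + ρ.im ^ 2 := by
      rw [Complex.sq_norm, Complex.normSq_apply]
      simp; ring
    have hR2le : ‖(lam : ℂ) - ρ‖ ^ 2 ≤ (lam + c) ^ 2 + |C| * lam := by
      rw [hR2]
      have h1 : (lam - ρ.re) ^ 2 ≤ (lam + c) ^ 2 := pow_le_pow_left₀ hlamβ.le hlamβ' 2
      have h2 : ρ.im ^ 2 ≤ |C| * lam :=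
        le_trans hγC (mul_le_mul_of_nonneg_right (le_abs_self C) hlampos.le)
      linarith
    have hexp : Real.exp (1 - x * (lam - σ₁) / lam) = Real.exp (1 - x) * Real.exp (x * σ₁ / lam) := by
      rw [← Real.exp_add]; congr 1; field_simp; ring
    set L := x * Real.exp (1 - x * (lam - σ₁) / lam) * ‖(lam : ℂ) - ρ‖ with hL_def
    have hLnn : 0 ≤ L := by positivity
    have hL : L = κ * Real.exp (x * σ₁ / lam) * ‖(lam : ℂ) - ρ‖ := by
      rw [hL_def, hexp, hκ_def]; ring
    have hL2 : L ^ 2 ≤ κ ^ 2 * Real.exp (2 * x * σ₁ / lam) * ((lam + c) ^ 2 + |C| * lam) := by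
      rw [hL, mul_pow, mul_pow, ← Real.exp_nat_mul]
      have : ((2 : ℕ) : ℝ) * (x * σ₁ / lam) = 2 * x * σ₁ / lam := by push_cast; ring
      rw [this]
      exact mul_le_mul_of_nonneg_left hR2le (by positivity)
    have hlt : κ ^ 2 * Real.exp (2 * x * σ₁ / lam) * ((lam + c) ^ 2 + |C| * lam) < lam ^ 2 := by
      have hlam2 : 0 < lam ^ 2 := by positivity
      have := hii
      rw [← mul_div_assoc, div_lt_one hlam2] at this
      exact this
    have hL2' : L ^ 2 < lam ^ 2 := lt_of_le_of_lt hL2 hlt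
    exact lt_of_pow_lt_pow_left₀ 2 hlampos.le hL2'
  · -- (iii) the rate
    have hrate : Real.pi * polePairRate lam x ρ =
        lam * Real.arctan (ρ.im / (lam - ρ.re)) / x := by
      rw [polePairRate]
      field_simp
    rw [hrate, le_div_iff₀ hxpos]
    have hmono : Real.arctan (Γ / (lam + c)) ≤ Real.arctan (ρ.im / (lam - ρ.re)) := by
      apply Real.arctan_le_arctan_iff.2
      calc Γ / (lam + c) ≤ Γ / (lam - ρ.re) := div_le_div_of_nonneg_left hΓ.le hlamβ hlamβ'
        _ ≤ ρ.im / (lam - ρ.re) := div_le_div_of_nonneg_right hγ hlamβ.le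
    have h1 : lam * Real.arctan (Γ / (lam + c)) ≤ lam * Real.arctan (ρ.im / (lam - ρ.re)) :=
      mul_le_mul_of_nonneg_left hmono hlampos.le
    -- (Γ − ε) x ≤ Γ − ε/2
    have h2 : (Γ - ε) * x ≤ Γ - ε / 2 := by
      rw [hx_def]
      have hδΓ : δ * Γ ≤ ε / 2 := by
        have := hδε; rw [le_div_iff₀ (by positivity)] at this; linarith
      nlinarith
    linarith
  
/-! ## §2 PieceB -/

/-- **PieceB of the moment-method proof of Theorem B** (pole bookkeeping / "infinite height"):
under exactly the hypotheses of `Grosswald1967_thmB` — `g·x^{-(σ₁+1)}` integrable on `(1,∞)`,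
`Φ` meromorphic on `{θ − ε₀ < re}`, holomorphic on `{θ < re}` and on the box
`{θ − η < re, |im| < Γ}`, `Φ = F` on `{σ₁ < re}`, `F` continuable to no `{θ − ε < re}` — for every
`ε > 0` there are admissible pole-pair data `(λ, x, R', ρ, Ψ)` (`AdmissiblePolePair`) with
`Γ − ε ≤ π · polePairRate λ x ρ = λ·arctan(γ/(λ−β))/x`.  Proof: `stub_nearestPole` gives `C` and, for
the `Λ₀` of `stub_rateLimit`, a generic real `λ ≥ Λ₀` whose nearest pole `ρ` of the normal form of
`Φ` satisfies `θ − η < β ≤ θ`, `Γ ≤ γ`, `γ² ≤ Cλ`; `stub_rateLimit` supplies `x` and the three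
inequalities.  Both of Grosswald's cases (`P ≠ ∅`, and `P = ∅` i.e. Pólya's `γ = +∞`, completed by
Steinig 1969) are covered by the same construction.  Together with `PieceA` this yields
`Grosswald1967_thmB` via `grosswald1967_thmB_of`. [cite: Grosswald1967, §4 Thm B pp. 4–5] -/
theorem pieceB : PieceB := by
  intro g σ₁ θ ε₀ Φ hint hθ hε₀ hmer hhol heq hno Γ η hΓ hη hbox ε hε
  obtain ⟨C, hC⟩ := stub_nearestPole g σ₁ θ ε₀ Φ hint hθ hε₀ hmer hhol heq hno Γ η hΓ hη hbox
  obtain ⟨x, Λ₀, hx, hΛ⟩ := stub_rateLimit σ₁ θ η Γ C ε hΓ hε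
  obtain ⟨lam, R', ρ, Ψ, hlam, hβ1, hβ2, hγ, hγ2, hadm⟩ := hC Λ₀
  obtain ⟨h1, h2, h3⟩ := hΛ lam ρ hlam hβ1 hβ2 hγ hγ2
  exact ⟨lam, x, R', ρ, Ψ, hadm x hx h1 h2, h3⟩

end Literature.NumberTheory.LFunctions.PolyaSignChanges

end
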